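import Literature.AlgebraicGeometry.Motives.AbelianVarietyQuotientGroup
import Literature.AlgebraicGeometry.Motives.AbelianVarietyTateModuleAlong
import Literature.AlgebraicGeometry.Motives.AbelianVarietyTorsionPointsCountProofs
import Literature.AlgebraicGeometry.Motives.AbelianVarietyTorsionCubeProofs
import Literature.AlgebraicGeometry.Motives.AbelianVarietyIsogenyPairFlip
import Literature.AlgebraicGeometry.Motives.AbelianVarietyFrobeniusCharpolyRigidity
import Literature.AlgebraicGeometry.Motives.TateAbelianFiniteLatticeProofs
import Literature.AlgebraicGeometry.HodgeTheory.AbelianVarietyIsogenyKernelsLattices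
import Literature.NumberTheory.DiophantineGeometry.AVIsogenyTateInjectiveProofs
import HarnessLib

/-!
# Descent of models along isogenies: a complex abelian variety isogenous to the base change of an
# abelian variety over an algebraically closed `k ⊆ ℂ` is itself (the base change of) one over `k` —
# together with any ring of endomorphisms (Mumford §7 Thm. 4; Shimura 1998, §12.4 Prop. 26)

Layer `Literature/AlgebraicGeometry/Motives`, namespace `Literature.AlgebraicGeometry.Motives.AbelianVariety`.
KERNEL ONLY: theorems; no definition, no instance, no named fact, no `sorry` (net Literature debt 0).
Cell `hodgecm-mathlib` (D-0151), row II-2β `shimura1998_prop26_definedOverQbar` (Shimura 1998 §12.4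
PROPOSITION 26: «any structure `(A, 𝒞, ι)` of a CM type is isomorphic to one defined over an algebraic
number field» — here the `ℚ̄`-half), piece F3 of A-p03's PREP-II2beta-Prop26Qbar (director g1 03:16Z /
03:21Z).  The print (p. 109) specialises a generic structure; the lattice class of the specialisation is
then adjusted by an ISOGENY with prescribed finite kernel — Mumford, *Abelian Varieties* §7 Thm. 4 p. 72
(«`X/S` … every separable isogeny is of this form»), which is what this file supplies in the form needed:

* §1 `mem_kerPoints_baseChange_iff` — the complex points of the kernel of `h₀ ⊗ ℂ` for `h₀ : A₀ → B₀` over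
  `k ⊆ ℂ` are the `ℂ`-valued points `x` of `A₀` with `x ≫ h₀ = 1` (`pointsMulEquiv_map`);
  `exists_pointsMulEquiv_extendScalars_eq_of_mem_torsionPoints` — for `k` ALGEBRAICALLY CLOSED every torsion
  point of `(A₀ ⊗ ℂ)(ℂ)` is the base change of a `k`-point of `A₀` (Mumford §6 App. 3: both torsion groups
  have `n^{2g}` elements, `natCard_torsionPoints_eq_of_isAlgClosed`);
* §2 `exists_comp_eq_comp_of_isIsogeny_of_kerPoints` — **descent of homomorphisms through isogenies over any
  field** (Milne 1986 §8 / Lemma 12.6, Mumford §7 Thm. 4): for an isogeny `h : A → B` with `Ker h ⊆ A[N]`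
  (`N` invertible in `k`), an isogeny/homomorphism `h′ : A′ → B′` and `u : A → A′` carrying the `k̄`-points of
  `Ker h` into those of `Ker h′`, there is `ψ : B → B′` with `h ≫ ψ = u ≫ h′` (via the quasi-inverse `f` of `h`,
  `h f = N`: `f u h′` kills `B[N](k̄)`, so equals `N ψ` by Milne's Lemma 12.6 = the tree's
  `exists_eq_nsmul_of_forall_geomTorsion`, and `N (h ψ) = N (u h′)` in the torsion-free `Hom(A, B′)`);
  `exists_ringHom_end_comp_eq` — hence a ring of endomorphisms `ι : R → End A` preserving `Ker h (k̄)` DESCENDS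
  to `ι_B : R → End B` with `ι(r) ≫ h = h ≫ ι_B(r)`;
* §3 **`exists_model_of_isIsogeny_baseChange`** — MAIN: `k ⊆ ℂ` algebraically closed, `A₀ / k`, `A / ℂ`,
  `g : A₀ ⊗ ℂ → A` an isogeny, `ι₀ : R → End A₀`, `ι : R → End A` with `g` equivariant ⟹ there are
  `B₀ / k`, `ι_B : R → End B₀`, an equivariant isogeny `h₀ : A₀ → B₀` and an EQUIVARIANT ISOMORPHISM
  `e : B₀ ⊗ ℂ ≅ A` with `(h₀ ⊗ ℂ) ≫ e = g`.  Construction: `S₀ ⊆ A₀(k)` := the `k`-points under `Ker g (ℂ)`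
  (all of it, by §1), `B₀ := A₀/S₀` (the tree's `AbelianVariety.quot`, Mumford §7 Thm. 4), `Ker (h₀ ⊗ ℂ)(ℂ) =
  Ker g (ℂ)` (`comp_quotientMapOver_eq_one_iff`), so `e` exists by the uniqueness of isogenies with given complex
  kernel (`IsIsogeny.exists_iso_comp_eq_of_kerPoints_complex_eq`); `ι_B` by §2.
  `exists_iso_baseChange_of_isIsogeny_baseChange` — the bare `∃ (B₀, ι_B, e)` form = the conclusion shape of
  `Literature.NumberTheory.ComplexMultiplication.shimura1998_prop26_definedOverQbar`.

## References
* [MumfordAV1970] D. Mumford, *Abelian Varieties* (1970), §6 Application 3 (p. 64), §7 Thm. 4 (p. 72), §19.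
* [Milne1986AbelianVarieties] J. S. Milne, *Abelian varieties*, in Cornell–Silverman (1986), §8 (isogenies, quotients),
  Lemma 12.6.
* [Shimura1998] G. Shimura, *Abelian Varieties with Complex Multiplication and Modular Functions* (1998), §12.4
  Prop. 26 (p. 109).
* [Lange2023AbelianVarietiesComplex] H. Lange, *Abelian Varieties over the Complex Numbers* (2023), §1.1.2 Prop. 1.1.15.
-/

universe u

open CategoryTheory AlgebraicGeometry

noncomputable section

namespace Literature.AlgebraicGeometry.Motives

namespace AbelianVariety

open scoped MonObj

/-! ## §1 Complex points of kernels of base-changed homomorphisms; torsion points come from `k` -/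

section Points

variable {k : Type} [Field k] [Algebra k ℂ] {A₀ B₀ : AbelianVariety k}

/-- **Complex points of `Ker (h₀ ⊗ ℂ)`**: for `h₀ : A₀ → B₀` over `k ⊆ ℂ` and a complex point `P = x_ℂ` of
`A₀ ⊗ ℂ` (`x` the corresponding `ℂ`-valued point of the `k`-scheme `A₀`, `pointsMulEquiv`):
`P ∈ Ker (h₀ ⊗ ℂ)(ℂ) ↔ x ≫ h₀ = 1`. [cite: MumfordAV1970, §4 (points) and §7 Thm. 4 (p. 72)] -/
theorem mem_kerPoints_baseChange_iff (h₀ : A₀ ⟶ B₀) (x : A₀.Points ℂ) :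
    A₀.pointsMulEquiv ℂ x ∈ Hom.kerPoints (specOver ℂ ℂ) (Hom.baseChange ℂ h₀) ↔
      x ≫ h₀.hom.hom.hom = 1 := by
  rw [Hom.mem_kerPoints_iff]
  change AlgPoints.map (Hom.baseChange ℂ h₀).hom.hom.hom (A₀.pointsMulEquiv ℂ x) = 1 ↔
    AlgPoints.map h₀.hom.hom.hom x = 1
  rw [← pointsMulEquiv_map, MulEquiv.map_eq_one_iff]

/-- **Every torsion point of `(A₀ ⊗ ℂ)(ℂ)` comes from `A₀(k)` when `k` is algebraically closed** (Mumford §6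
App. 3: `A₀[n](k)` and `(A₀ ⊗ ℂ)[n](ℂ)` both have `n^{2 dim}` elements, and `s ↦ (s)_ℂ` is injective).
[cite: MumfordAV1970, §6 Application 3 (Proposition p. 64)] -/
theorem exists_pointsMulEquiv_extendScalars_eq_of_mem_torsionPoints [IsAlgClosed k] [CharZero k]
    {n : ℤ} (hn : n ≠ 0) {P : (A₀.baseChange ℂ).Points ℂ} (hP : P ∈ (A₀.baseChange ℂ).torsionPoints ℂ n) :
    ∃ s ∈ A₀.torsionPoints k n, A₀.pointsMulEquiv ℂ (AlgPoints.extendScalars A₀.X k ℂ s) = P := by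
  have hnk : (n : k) ≠ 0 := by exact_mod_cast hn
  have hnC : (n : ℂ) ≠ 0 := by exact_mod_cast hn
  -- the restricted map `A₀[n](k) → (A₀ ⊗ ℂ)[n](ℂ)`
  let φ : A₀.Points k →* (A₀.baseChange ℂ).Points ℂ :=
    (A₀.pointsMulEquiv ℂ).toMonoidHom.comp (AlgPoints.extendScalarsMonoidHom A₀.X k ℂ)
  have hφ : ∀ s : A₀.Points k, φ s = A₀.pointsMulEquiv ℂ (AlgPoints.extendScalars A₀.X k ℂ s) := fun s => rfl
  have hφinj : Function.Injective φ := fun s t hst =>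
    AlgPoints.extendScalars_injective A₀.X k ℂ ((A₀.pointsMulEquiv ℂ).injective hst)
  have hφtors : ∀ s ∈ A₀.torsionPoints k n, φ s ∈ (A₀.baseChange ℂ).torsionPoints ℂ n := fun s hs => by
    rw [mem_torsionPoints_iff] at hs ⊢
    rw [← map_zpow, hs, map_one]
  let f : A₀.torsionPoints k n → (A₀.baseChange ℂ).torsionPoints ℂ n := fun s => ⟨φ s.1, hφtors s.1 s.2⟩
  have hf : Function.Injective f := fun s t hst => Subtype.ext (hφinj (congrArg Subtype.val hst))
  haveI : Finite ((A₀.baseChange ℂ).torsionPoints ℂ n) := by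
    apply Nat.finite_of_card_ne_zero
    rw [(A₀.baseChange ℂ).natCard_torsionPoints_eq_of_isAlgClosed ℂ n hnC]
    exact pow_ne_zero _ (Int.natAbs_ne_zero.mpr hn)
  have hcard : Nat.card ((A₀.baseChange ℂ).torsionPoints ℂ n) ≤ Nat.card (A₀.torsionPoints k n) := by
    rw [(A₀.baseChange ℂ).natCard_torsionPoints_eq_of_isAlgClosed ℂ n hnC,
      A₀.natCard_torsionPoints_eq_of_isAlgClosed k n hnk, dim_baseChange]
  obtain ⟨s, hs⟩ := (hf.bijective_of_nat_card_le hcard).2 ⟨P, hP⟩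
  exact ⟨s.1, s.2, (hφ s.1).symm.trans (congrArg Subtype.val hs)⟩

/-- The base change of a `k`-point and of a homomorphism commute: `((s)_ℂ ≫ u_ℂ) = (s ≫ u)_ℂ`.
[cite: MumfordAV1970, §4] -/
theorem pointsMulEquiv_extendScalars_map (u : A₀ ⟶ B₀) (s : A₀.Points k) :
    AlgPoints.map (Hom.baseChange ℂ u).hom.hom.hom (A₀.pointsMulEquiv ℂ (AlgPoints.extendScalars A₀.X k ℂ s)) =
      B₀.pointsMulEquiv ℂ (AlgPoints.extendScalars B₀.X k ℂ (AlgPoints.map u.hom.hom.hom s)) := by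
  rw [← pointsMulEquiv_map]
  rfl

end Points

/-! ## §2 Descent of homomorphisms and of endomorphism rings through isogenies (Milne Lemma 12.6) -/

section Descent

variable {k : Type u} [Field k] {A B A' B' : AbelianVariety k}

/-- **Descent of a homomorphism through isogenies, over any field.**  Let `h : A → B` be an isogeny with
`Ker h ⊆ A[N]` scheme-theoretically, `N` invertible in `k`, let `h′ : A′ → B′` be a homomorphism and
`u : A → A′` a homomorphism such that `u` carries the `k̄`-points of `Ker h` into those of `Ker h′`.  Then
`u` descends: `h ≫ ψ = u ≫ h′` for some `ψ : B → B′`.  Proof: with the quasi-inverse `f : B → A`, `h f = N`,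
`f h = N` (`IsIsogeny.exists_isogeny_comp_eq_nsmul_id`), the homomorphism `φ = f u h′ : B → B′` kills
`B[N](k̄)` (a point `P = h(Q)` of order `N` has `Q^N ∈ Ker h (k̄)`, and `φ(P) = h′(u(Q^N)) = 1`), so
`φ = N ψ` (Milne Lemma 12.6, `exists_eq_nsmul_of_forall_geomTorsion`), and `N (h ψ) = h φ = N (u h′)` in the
torsion-free group `Hom(A, B′)`. [cite: Milne1986AbelianVarieties, §8 (PDF p. 181: "n_A factors as g ∘ f") and Lemma 12.6]
[cite: MumfordAV1970, §7 Thm. 4 (p. 72)] -/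
theorem exists_comp_eq_comp_of_isIsogeny_of_kerPoints {h : A ⟶ B} (hh : IsIsogeny h) {N : ℕ}
    (hN : (N : k) ≠ 0) (hle : ∀ T : SchemeOver k, Hom.kerPoints T h ≤ Hom.kerPoints T (N • 𝟙 A))
    (h' : A' ⟶ B') (u : A ⟶ A')
    (hu : ∀ x : A.Points (AlgebraicClosure k), x ≫ h.hom.hom.hom = 1 →
      (x ≫ u.hom.hom.hom) ≫ h'.hom.hom.hom = 1) :
    ∃ ψ : B ⟶ B', h ≫ ψ = u ≫ h' := by
  obtain ⟨f, -, hhf, hfh⟩ := hh.exists_isogeny_comp_eq_nsmul_id hN hle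
  -- `φ = f u h′` kills `B[N](k̄)`
  have hkill : ∀ P ∈ B.geomTorsion (N : ℕ), Hom.geomPointsMap (f ≫ u ≫ h') P = 0 := by
    intro P hP
    rw [mem_geomTorsion_iff, mem_torsionPoints_iff, zpow_natCast] at hP
    obtain ⟨Q, hQ⟩ := hh.exists_comp_eq (Additive.toMul P)
    -- `Q^N ∈ Ker h (k̄)`
    have hQN : (Q ^ N) ≫ h.hom.hom.hom = 1 := by
      rw [MonObj.pow_comp, hQ]
      exact hP
    have h1 := hu (Q ^ N) hQN
    -- `Q ≫ [N] = Q^N`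
    have hQpow : Q ≫ ((N • 𝟙 A :) ).hom.hom.hom = Q ^ N := by
      rw [← natCast_zsmul, hom_zsmul_id, GrpObj.comp_zpow, Category.comp_id, zpow_natCast]
    -- `φ(P) = h′(u(f(h Q))) = h′(u(Q^N))`
    have h2 : Additive.toMul (Hom.geomPointsMap (f ≫ u ≫ h') P) = 1 := by
      change Additive.toMul P ≫ (f ≫ u ≫ h').hom.hom.hom = 1
      rw [← hQ, Category.assoc]
      change Q ≫ (h ≫ f ≫ u ≫ h').hom.hom.hom = 1
      rw [← Category.assoc h f, hhf]
      change Q ≫ (((N • 𝟙 A :) ).hom.hom.hom ≫ u.hom.hom.hom ≫ h'.hom.hom.hom) = 1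
      rw [← Category.assoc, ← Category.assoc, hQpow]
      exact h1
    exact congrArg Additive.ofMul h2
  obtain ⟨ψ, hψ⟩ := exists_eq_nsmul_of_forall_geomTorsion N hN (f ≫ u ≫ h') hkill
  refine ⟨ψ, eq_of_nsmul_eq_nsmul hN ?_⟩
  calc N • (h ≫ ψ) = h ≫ ((N : ℤ) • ψ) := by rw [← Preadditive.comp_nsmul, natCast_zsmul]
    _ = (h ≫ f) ≫ u ≫ h' := by rw [← hψ, Category.assoc]
    _ = N • (u ≫ h') := by rw [hhf, Preadditive.nsmul_comp, Category.id_comp]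

/-- **Descent of a ring of endomorphisms through an isogeny.**  If `h : A → B` is an isogeny and every
`ι(r) ≫ h`, `r ∈ R`, factors through `h`, then the factorisations assemble to a ring homomorphism
`ι_B : R → End B` with `ι(r) ≫ h = h ≫ ι_B(r)` (uniqueness of the factorisation: an isogeny is an
epimorphism of abelian varieties, `IsIsogeny.cancel_left`).  Shimura §7.1: an isogeny of `(A, ι)` onto `A′`
transports `ι` to `ι′` («`λ ι(a) = ι′(a) λ`»). [cite: Shimura1998, §7.1 (homomorphisms of (A, ι), p. 50)] [cite: MumfordAV1970, §7 Thm. 4 (p. 72)] -/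
theorem exists_ringHom_end_comp_eq {h : A ⟶ B} (hh : IsIsogeny h) {R : Type*} [Semiring R]
    (ρ : R →+* End A) (hex : ∀ r : R, ∃ ψ : B ⟶ B, h ≫ ψ = (ρ r : A ⟶ A) ≫ h) :
    ∃ ρB : R →+* End B, ∀ r : R, (ρ r : A ⟶ A) ≫ h = h ≫ (ρB r : B ⟶ B) := by
  choose ψ hψ using hex
  have huniq : ∀ (r : R) (φ : B ⟶ B), h ≫ φ = (ρ r : A ⟶ A) ≫ h → φ = ψ r := fun r φ hφ =>
    hh.cancel_left (hφ.trans (hψ r).symm)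
  refine ⟨{ toFun := ψ
            map_one' := ?_
            map_mul' := fun r s => ?_
            map_zero' := ?_
            map_add' := fun r s => ?_ }, fun r => (hψ r).symm⟩
  · symm
    apply huniq
    rw [map_one]
    change h ≫ 𝟙 B = 𝟙 A ≫ h
    rw [Category.comp_id, Category.id_comp]
  · symm
    apply huniq
    rw [map_mul]
    change h ≫ (ψ s ≫ ψ r) = ((ρ s : A ⟶ A) ≫ (ρ r : A ⟶ A)) ≫ h
    rw [← Category.assoc, hψ s, Category.assoc, hψ r, Category.assoc]
  · symm
    apply huniq
    rw [map_zero]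
    change h ≫ 0 = (0 : A ⟶ A) ≫ h
    rw [Limits.comp_zero, Limits.zero_comp]
  · symm
    apply huniq
    rw [map_add]
    change h ≫ (ψ r + ψ s) = _
    rw [Preadditive.comp_add, hψ r, hψ s]
    exact (Preadditive.add_comp _ _ _ _ _ _).symm

end Descent

/-! ## §3 The quotient by a finite subgroup of rational points, with its kernel on all field-valued points -/

section Quotient

variable {k : Type u} [Field k] (A₀ : AbelianVariety k)

/-- Over `k/k` every subgroup of `A₀(k)` is Galois stable (`Aut(k/k) = 1`). [folklore] -/
private theorem smul_mem_of_algEquiv_self' (S : Subgroup (A₀.Points k)) (σ : k ≃ₐ[k] k) (s : A₀.Points k)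
    (hs : s ∈ S) : σ • s ∈ S := by
  have hσ : σ = 1 := AlgEquiv.ext fun x => by simpa using σ.commutes x
  rw [hσ, one_smul]
  exact hs

/-- **Mumford §7 Thm. 4 for a finite subgroup `S ⊆ A₀(k)` of RATIONAL points killed by `N` (invertible in `k`):
there is an isogeny `h₀ : A₀ → B₀` with `Ker h₀ ⊆ A₀[N]` scheme-theoretically whose kernel on `Ω`-valued points,
for EVERY field `Ω ⊇ k`, is exactly `S`: `x ≫ h₀ = 1 ↔ x = s_Ω` for some `s ∈ S`** (the tree's quotient
`AbelianVariety.quot` by `S ⋊ Gal(k/k) = S`, its isogeny `quotHom`, and the fibre computation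
`comp_quotientMapOver_eq_one_iff`). [cite: MumfordAV1970, §7 Thm. 4 (p. 72)] [cite: Milne1986AbelianVarieties, §8 (quotient by a finite subgroup)] -/
theorem exists_isIsogeny_comp_eq_one_iff_of_subgroup (S : Subgroup (A₀.Points k)) [Finite S] {N : ℕ}
    (hN : (N : k) ≠ 0) (hSN : S ≤ A₀.torsionPoints k N) :
    ∃ (B₀ : AbelianVariety k) (h₀ : A₀ ⟶ B₀), IsIsogeny h₀ ∧
      (∀ (Ω : Type u) [Field Ω] [Algebra k Ω] (x : A₀.Points Ω),
        x ≫ h₀.hom.hom.hom = 1 ↔ ∃ s ∈ S, x = AlgPoints.extendScalars A₀.X k Ω s) ∧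
      ∀ T : SchemeOver k, Hom.kerPoints T h₀ ≤ Hom.kerPoints T (N • 𝟙 A₀) := by
  have hN0 : N ≠ 0 := by
    rintro rfl
    exact hN Nat.cast_zero
  have hNz : ((N : ℕ) : ℤ) ≠ 0 := Int.natCast_ne_zero.mpr hN0
  have hq : IsFinite (Hom.toSchemeHom (((N : ℕ) : ℤ) • 𝟙 A₀)) := (isIsogeny_zsmul_id_holds A₀ _ hNz).2
  haveI : IsAffineHom (Hom.toSchemeHom (((N : ℕ) : ℤ) • 𝟙 A₀)) := by
    haveI := hq
    infer_instance
  have hSq : ∀ s ∈ S, s ≫ ((((N : ℕ) : ℤ) • 𝟙 A₀ :) ).hom.hom.hom = 1 := fun s hs => by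
    have h := hSN hs
    rw [mem_torsionPoints_iff] at h
    rw [hom_zsmul_id, GrpObj.comp_zpow, Category.comp_id]
    exact h
  refine ⟨A₀.quot k S (A₀.smul_mem_of_algEquiv_self' S) _ hSq hq,
    A₀.quotHom k S (A₀.smul_mem_of_algEquiv_self' S) _ hSq hq,
    A₀.isIsogeny_quotHom k S (A₀.smul_mem_of_algEquiv_self' S) _ hSq hq, fun Ω _ _ x => ?_, fun T x hx => ?_⟩
  · -- the fibre over the origin on `Ω`-points
    have hlam : (specOver k Ω).hom ≫ bcSpec k k = (specOver k Ω).hom := by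
      change Spec.map _ ≫ Spec.map _ = Spec.map _
      rw [← Spec.map_comp, ← CommRingCat.ofHom_comp, Algebra.algebraMap_self, RingHom.comp_id]
    have h := A₀.comp_quotientMapOver_eq_one_iff k S (A₀.smul_mem_of_algEquiv_self' S) _ hSq
      (specOver k Ω).hom (specOver k Ω).hom hlam x
    have hmk : (Over.homMk (specOver k Ω).hom hlam : Over.mk (specOver k Ω).hom ⟶ specOver k k) =
        AlgPoints.specOverMap k Ω := Over.OverMorphism.ext rfl
    rw [quotHom_hom]
    have hpt : ∀ s : A₀.Points k,
        (Over.homMk (specOver k Ω).hom hlam : Over.mk (specOver k Ω).hom ⟶ specOver k k) ≫ s =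
          AlgPoints.extendScalars A₀.X k Ω s := fun s => by
      rw [hmk]
      rfl
    refine h.trans ⟨?_, ?_⟩
    · rintro ⟨s, hs⟩
      exact ⟨s.1, s.2, hs.trans (hpt s.1)⟩
    · rintro ⟨s, hs, hxs⟩
      exact ⟨⟨s, hs⟩, hxs.trans (hpt s).symm⟩
  · -- `Ker h₀ ⊆ Ker [N]`
    rw [Hom.mem_kerPoints_iff] at hx ⊢
    rw [← natCast_zsmul]
    exact A₀.comp_eq_one_of_comp_quotientMapOver_eq_one k S (A₀.smul_mem_of_algEquiv_self' S) _ hSq x hx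

end Quotient

/-! ## §4 Descent of models along isogenies `A₀ ⊗ ℂ → A` -/

section Model

variable {k : Type} [Field k] [IsAlgClosed k] [CharZero k] [Algebra k ℂ]

/-- **Descent of models along isogenies.**  Let `k ⊆ ℂ` be an algebraically closed field, `A₀` an abelian variety
over `k`, `A` a complex abelian variety and `g : A₀ ⊗ ℂ → A` an ISOGENY; let `ρ₀ : R → End A₀`, `ρ : R → End A`
be actions of a (semi)ring `R` for which `g` is equivariant.  Then `A` with its `R`-action is itself defined over
`k`: there are an abelian variety `B₀` over `k` with `ρ_B : R → End B₀`, an `R`-equivariant isogeny `h₀ : A₀ → B₀`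
and an `R`-EQUIVARIANT ISOMORPHISM `e : B₀ ⊗ ℂ ≅ A` with `(h₀ ⊗ ℂ) ≫ e = g`.  Construction: the kernel
`Ker g (ℂ)` is a finite group of torsion points, all of which come from `k`-points of `A₀` (§1); `B₀ := A₀/S₀` is
the quotient by that finite subgroup `S₀ ⊆ A₀(k)` (Mumford §7 Thm. 4, §3), `Ker (h₀ ⊗ ℂ)(ℂ) = Ker g (ℂ)`, so
`B₀ ⊗ ℂ ≅ A` under `A₀ ⊗ ℂ` by the uniqueness of the isogeny with given complex kernel
(`IsIsogeny.exists_iso_comp_eq_of_kerPoints_complex_eq`), and `ρ₀` descends through `h₀` (§2) because `S₀` is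
`ρ₀`-stable, `g` being equivariant.  This is the step «adjust the specialised structure by an isogeny» of
Shimura's proof that a CM structure is defined over `ℚ̄`. [cite: Shimura1998, §12.4 Prop. 26 (p. 109)]
[cite: MumfordAV1970, §7 Thm. 4 (p. 72)] [cite: Lange2023AbelianVarietiesComplex, §1.1.2 Prop. 1.1.15] -/
theorem exists_model_of_isIsogeny_baseChange (A₀ : AbelianVariety k) {A : AbelianVariety ℂ}
    (g : A₀.baseChange ℂ ⟶ A) (hg : IsIsogeny g) {R : Type*} [Semiring R] (ρ₀ : R →+* End A₀)
    (ρ : R →+* End A) (hρ : ∀ r : R, Hom.baseChange ℂ (ρ₀ r : A₀ ⟶ A₀) ≫ g = g ≫ (ρ r : A ⟶ A)) :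
    ∃ (B₀ : AbelianVariety k) (ρB : R →+* End B₀) (h₀ : A₀ ⟶ B₀) (e : B₀.baseChange ℂ ≅ A),
      IsIsogeny h₀ ∧ (∀ r : R, (ρ₀ r : A₀ ⟶ A₀) ≫ h₀ = h₀ ≫ (ρB r : B₀ ⟶ B₀)) ∧
      Hom.baseChange ℂ h₀ ≫ e.hom = g ∧
      ∀ r : R, Hom.baseChange ℂ (ρB r : B₀ ⟶ B₀) ≫ e.hom = e.hom ≫ (ρ r : A ⟶ A) := by
  classical
  -- the complex kernel `Ker g (ℂ)`, finite of order `N`, inside the `N`-torsion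
  haveI : IsFinite (Hom.toSchemeHom g) := hg.2
  haveI hfin : Finite (Hom.kerPoints (specOver ℂ ℂ) g) := finite_kerPoints_of_isFinite g ℂ
  set N : ℕ := Nat.card (Hom.kerPoints (specOver ℂ ℂ) g) with hNdef
  have hNpos : 0 < N := Nat.card_pos
  have hN0 : N ≠ 0 := hNpos.ne'
  have hNk : (N : k) ≠ 0 := Nat.cast_ne_zero.mpr hN0
  have hNZ : (N : ℤ) ≠ 0 := Int.natCast_ne_zero.mpr hN0
  have htors : Hom.kerPoints (specOver ℂ ℂ) g ≤ (A₀.baseChange ℂ).torsionPoints ℂ N :=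
    Literature.AlgebraicGeometry.HodgeTheory.AbelianVariety.kerPoints_le_torsionPoints_natCard g
  -- the points of `A₀(k)` under `Ker g (ℂ)`
  let φ : A₀.Points k →* (A₀.baseChange ℂ).Points ℂ :=
    (A₀.pointsMulEquiv ℂ).toMonoidHom.comp (AlgPoints.extendScalarsMonoidHom A₀.X k ℂ)
  have hφ : ∀ s : A₀.Points k, φ s = A₀.pointsMulEquiv ℂ (AlgPoints.extendScalars A₀.X k ℂ s) := fun s => rfl
  have hφinj : Function.Injective φ := fun s t hst =>
    AlgPoints.extendScalars_injective A₀.X k ℂ ((A₀.pointsMulEquiv ℂ).injective hst)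
  let S₀ : Subgroup (A₀.Points k) := (Hom.kerPoints (specOver ℂ ℂ) g).comap φ
  have hS₀ : ∀ s : A₀.Points k, s ∈ S₀ ↔ φ s ∈ Hom.kerPoints (specOver ℂ ℂ) g := fun s => Iff.rfl
  haveI : Finite S₀ :=
    Finite.of_injective (fun s : S₀ => (⟨φ s.1, (hS₀ s.1).1 s.2⟩ : Hom.kerPoints (specOver ℂ ℂ) g))
      fun s t hst => Subtype.ext (hφinj (congrArg Subtype.val hst))
  have hS₀N : S₀ ≤ A₀.torsionPoints k N := fun s hs => by
    have h1 : φ s ∈ (A₀.baseChange ℂ).torsionPoints ℂ N := htors ((hS₀ s).1 hs)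
    rw [mem_torsionPoints_iff] at h1 ⊢
    apply hφinj
    rw [map_zpow, h1, map_one]
  -- every point of `Ker g (ℂ)` comes from `S₀`
  have hsurj : ∀ P ∈ Hom.kerPoints (specOver ℂ ℂ) g, ∃ s ∈ S₀, φ s = P := fun P hP => by
    obtain ⟨s, -, hs⟩ := exists_pointsMulEquiv_extendScalars_eq_of_mem_torsionPoints (A₀ := A₀) hNZ (htors hP)
    refine ⟨s, ?_, hs⟩
    rw [hS₀, hφ, hs]
    exact hP
  -- `S₀` is `ρ₀`-stable (`g` is equivariant)
  have hstab : ∀ (r : R) (s : A₀.Points k), s ∈ S₀ →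
      AlgPoints.map (ρ₀ r : A₀ ⟶ A₀).hom.hom.hom s ∈ S₀ := fun r s hs => by
    rw [hS₀, hφ, ← pointsMulEquiv_extendScalars_map, ← hφ, Hom.mem_kerPoints_iff]
    have hs' := (Hom.mem_kerPoints_iff g (φ s)).1 ((hS₀ s).1 hs)
    change (φ s ≫ (Hom.baseChange ℂ (ρ₀ r : A₀ ⟶ A₀)).hom.hom.hom) ≫ g.hom.hom.hom = 1
    rw [Category.assoc]
    change φ s ≫ (Hom.baseChange ℂ (ρ₀ r : A₀ ⟶ A₀) ≫ g).hom.hom.hom = 1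
    rw [hρ r]
    change (φ s ≫ g.hom.hom.hom) ≫ (ρ r : A ⟶ A).hom.hom.hom = 1
    rw [hs', MonObj.one_comp]
  -- the quotient `h₀ : A₀ → B₀ = A₀/S₀`
  obtain ⟨B₀, h₀, hh₀, hker, hle⟩ := A₀.exists_isIsogeny_comp_eq_one_iff_of_subgroup S₀ hNk hS₀N
  -- `Ker (h₀ ⊗ ℂ)(ℂ) = Ker g (ℂ)`
  have hkereq : Hom.kerPoints (specOver ℂ ℂ) (Hom.baseChange ℂ h₀) = Hom.kerPoints (specOver ℂ ℂ) g := by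
    ext P
    obtain ⟨x, rfl⟩ := (A₀.pointsMulEquiv ℂ).surjective P
    rw [mem_kerPoints_baseChange_iff, hker ℂ x]
    constructor
    · rintro ⟨s, hs, rfl⟩
      rw [← hφ]
      exact (hS₀ s).1 hs
    · intro hP
      obtain ⟨s, hs, hsP⟩ := hsurj _ hP
      refine ⟨s, hs, (A₀.pointsMulEquiv ℂ).injective ?_⟩
      rw [← hφ, hsP]
  obtain ⟨e, he⟩ := IsIsogeny.exists_iso_comp_eq_of_kerPoints_complex_eq (hh₀.baseChange ℂ) hg hkereq
  -- `ρ₀` descends through `h₀`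
  have hex : ∀ r : R, ∃ ψ : B₀ ⟶ B₀, h₀ ≫ ψ = (ρ₀ r : A₀ ⟶ A₀) ≫ h₀ := fun r =>
    exists_comp_eq_comp_of_isIsogeny_of_kerPoints hh₀ hNk hle h₀ (ρ₀ r : A₀ ⟶ A₀) fun x hx => by
      obtain ⟨s, hs, rfl⟩ := (hker (AlgebraicClosure k) x).1 hx
      exact (hker (AlgebraicClosure k) _).2 ⟨_, hstab r s hs, rfl⟩
  obtain ⟨ρB, hρB⟩ := exists_ringHom_end_comp_eq hh₀ ρ₀ hex
  refine ⟨B₀, ρB, h₀, e, hh₀, hρB, he, fun r => (hh₀.baseChange ℂ).cancel_left ?_⟩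
  rw [← Category.assoc, ← Hom.baseChange_comp, ← hρB r, Hom.baseChange_comp, Category.assoc, he,
    ← Category.assoc, he]
  exact hρ r

/-- **A complex abelian variety with `R`-action isogenous (equivariantly) to the base change of one defined over
an algebraically closed `k ⊆ ℂ` is equivariantly isomorphic to the base change of one defined over `k`** — the
`∃ (B₀, ρ_B, e)` form of `exists_model_of_isIsogeny_baseChange`, in the conclusion shape of
`Literature.NumberTheory.ComplexMultiplication.shimura1998_prop26_definedOverQbar`.
[cite: Shimura1998, §12.4 Prop. 26 (p. 109)] [cite: MumfordAV1970, §7 Thm. 4 (p. 72)] -/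
theorem exists_iso_baseChange_of_isIsogeny_baseChange (A₀ : AbelianVariety k) {A : AbelianVariety ℂ}
    (g : A₀.baseChange ℂ ⟶ A) (hg : IsIsogeny g) {R : Type*} [Semiring R] (ρ₀ : R →+* End A₀)
    (ρ : R →+* End A) (hρ : ∀ r : R, Hom.baseChange ℂ (ρ₀ r : A₀ ⟶ A₀) ≫ g = g ≫ (ρ r : A ⟶ A)) :
    ∃ (B₀ : AbelianVariety k) (ρB : R →+* End B₀) (e : B₀.baseChange ℂ ≅ A),
      ∀ r : R, Hom.baseChange ℂ (ρB r : B₀ ⟶ B₀) ≫ e.hom = e.hom ≫ (ρ r : A ⟶ A) := by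
  obtain ⟨B₀, ρB, -, e, -, -, -, he⟩ := exists_model_of_isIsogeny_baseChange A₀ g hg ρ₀ ρ hρ
  exact ⟨B₀, ρB, e, he⟩

end Model


end AbelianVariety

end Literature.AlgebraicGeometry.Motives

end
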